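import Literature.AlgebraicGeometry.Resolution.AlterationsSemiStableResolution
import Literature.AlgebraicGeometry.Resolution.AlterationsNormalFormBlowup
import Literature.AlgebraicGeometry.Resolution.AlterationsBlowupDivisorProofs
import Literature.AlgebraicGeometry.Resolution.BlowupsEquivariant
import Literature.AlgebraicGeometry.Resolution.BlowupsExistence
import Literature.AlgebraicGeometry.Resolution.BlowupsIntegral
import Summits.ResolutionOfSingularities.ResolutionOfSingularities.Theorems.WildQuotientsSummitReductionSemiStablePairLemmas
import HarnessLib

/-!
# `WildQuotients.SummitReduction` (stmt-ResolutionOfSingularities-16324), line `FramePerfect`: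
# the equivariant iteration of blow-ups behind stub `stub_pair_ssOrbitBlowup` (de Jong 1997, 5.11 ¶3)

Route `ResolutionOfSingularities/WildQuotients`, crux `SummitReduction`; helper file of the line
skeleton `Cruxes/SummitReduction/Lines/FramePerfect.lean` (v6), stub B (`stub_pair_ssOrbitBlowup`).
Stub B is de Jong 1997, Prop. 5.11 ¶2–3 (= de Jong 1996, 3.5 and 4.25–4.28 made `G`-equivariant):
for a `G`-semi-stable pair with `codim(Sing X, X) ≥ 3`, a `G`-EQUIVARIANT projective modification
`ψ : X' ⟶ X` with `X'` regular and `ψ⁻¹(⋃ᵢ τᵢ(Y) ∪ f⁻¹ D)` a normal crossings divisor, obtained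
by "blow[ing] up in orbits of components of the singular locus of `X`. The resulting scheme has a
local description as above by the computations of [1, 4.27]. Hence we arrive at a regular scheme
`X'` with an action of `G` and a `G`-stable normal crossings divisor" (loc. cit. p. 619).

The tree proves the NON-equivariant iteration over an algebraically closed field
(`DeJong1996.NormalFormPair.exists_isModification_isRegular`, by induction on the number of
components of `Sing X` from Claim 4.27). This file proves, hypothesis-free, the EQUIVARIANT
iteration in the same shape, abstracting the formal-local invariant of Situation 4.25 (which the
tree only has over algebraically closed fields, `DeJong1996.NormalFormPair`) into an arbitrary
predicate `P X p ρ Z n` on `G`-schemes `p : X ⟶ Spec k` with boundary `Z` and a measure `n : ℕ`: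

* `isModification_id`, `exists_equivariant_isBlowup` — the identity is a modification; a blow-up
  of an integral projective `G`-variety in a non-zero `G`-stable ideal sheaf exists and is an
  integral projective `G`-variety along an equivariant modification (existence of blow-ups,
  Görtz–Wedhorn I 13.92; the action lifts, 13.91 (1); projectivity, Hartshorne II 7.16 (c));
* `exists_equivariant_modification_of_invariant` — **the iteration**: if measure `0` forces
  `X` regular with `Z` a normal crossings divisor, and positive measure yields a non-zero
  `G`-stable ideal sheaf every equivariant blow-up in which has smaller measure, then every
  `(X, ρ, Z)` satisfying `P` has an equivariant projective modification `ψ : X' ⟶ X` with `X'`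
  regular and `ψ⁻¹ Z` a normal crossings divisor (strong induction on the measure, composing
  modifications, de Jong 1996, 2.17);
* `ssOrbitBlowup_of_invariant` — the same in the exact shape of the conclusion of stub B;
* `normalFormPair_exists_isModification_of_invariant` — SANITY of the abstraction: over an
  algebraically closed field with the trivial action, the tree's leaves Claim 4.27
  (`DeJong1996NormalFormPairBlowup`) and the formal/étale comparison
  (`DeJong1996FormalNormalCrossings`) discharge `hzero`/`hstep` for
  `P := NormalFormPair ∧ #components(Sing X) = n ∧ ρ trivial`, recovering 4.25–4.28 for pairs in
  Situation 4.25 — the template for the generalized assembly;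
* the bookkeeping of ORBIT CENTRES used to feed the step: the singular locus is stable under
  automorphisms (`preimage_setOf_not_isRegularLocalRing_eq`), the `G`-orbit `⋃_g g·E` of a closed
  subset is closed and `G`-stable (`isClosed_iUnion_image`, `image_iUnion_image_eq`,
  `preimage_iUnion_image_eq`), so its reduced ideal sheaf is `G`-stable
  (`vanishingIdeal_orbit_comap_eq`) and non-zero once the orbit is a proper subset
  (`vanishingIdeal_ne_bot_of_ne_univ`).

What remains for stub B is the invariant itself at the generality of de Jong 1997 (arbitrary
ground field, quasi-split nodes, `G`-orbits): Situation 4.25 with residue-field coefficients, its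
entry (3.5 with 2.23/3.3 at all points of `Sing f`), Claim 4.27 for the blow-up in an orbit of
components, and the formal/étale comparison of normal crossings (Kollár 2007, 1.45 vs. 2.4).
-/

set_option linter.dupNamespace false

noncomputable section

open CategoryTheory CategoryTheory.Limits AlgebraicGeometry TopologicalSpace
open Literature.AlgebraicGeometry.Resolution
open Literature.AlgebraicGeometry

namespace Summit.ResolutionOfSingularities.ResolutionOfSingularities.Theorems

/-! ## Equivariant blow-ups as modifications -/

/-- The identity of an integral scheme is a modification (de Jong 1996, 2.17: integral source,
proper, birational — an isomorphism over the dense open `X`). [cite: DeJong1996, 2.17, pp. 59–60] -/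
theorem isModification_id (X : Scheme.{0}) [IsIntegral X] : IsModification (𝟙 X) :=
  ⟨inferInstance, inferInstance, ⊤, by simp, by simp, inferInstance⟩

/-- **One equivariant blow-up.** For an integral `X`, projective over the field `k`, with an
action `ρ : G →* Aut X` and a non-zero `G`-stable ideal sheaf `I` (`(ρ g)⁻¹ I = I`), there is a
blow-up `π : X' ⟶ X` of `X` in `I` (Görtz–Wedhorn I, Prop. 13.92); it is a modification with
integral source (de Jong 1996, 4.8), the action lifts uniquely to `X'` making `π` equivariant
(Görtz–Wedhorn I, Prop. 13.91 (1)), and `X'` is projective over `k` (Hartshorne II, 7.16 (c)).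
[cite: DeJong1996, 4.8, p. 67] -/
theorem exists_equivariant_isBlowup {k : Type} [Field k] {G : Type} [Group G] {X : Scheme.{0}}
    [IsIntegral X] (p : X ⟶ Spec (.of k)) (hproj : Motives.IsProjectiveOver (Over.mk p))
    (ρ : G →* Aut X) (I : X.IdealSheafData) (hI : I ≠ ⊥)
    (hIG : ∀ g : G, I.comap (ρ g).hom = I) :
    ∃ (X' : Scheme.{0}) (_ : IsIntegral X') (π : X' ⟶ X) (ρ' : G →* Aut X'),
      IsBlowup π I ∧ IsModification π ∧ (∀ g : G, (ρ' g).hom ≫ π = π ≫ (ρ g).hom) ∧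
        Motives.IsProjectiveOver (Over.mk (π ≫ p)) := by
  haveI : IsNoetherian X := DeJong1996.isNoetherian_of_isProjectiveOver p hproj
  obtain ⟨X', π, hπ⟩ := exists_isBlowup X I
  have hmod : IsModification π := IsModification.of_isBlowup hπ hI
  haveI := hmod.isIntegral
  exact ⟨X', inferInstance, π, hπ.liftAction ρ hIG, hπ, hmod, hπ.liftAction_hom_comp ρ hIG,
    hπ.isProjectiveOver p hproj⟩

/-! ## The iteration (de Jong 1996, 4.28; de Jong 1997, 5.11 ¶3) -/

/-- **Equivariant iteration of blow-ups** (de Jong 1996, 4.28, first sentence, made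
`G`-equivariant as in de Jong 1997, proof of Prop. 5.11: "Thus we blow up in orbits of components
of the singular locus of `X`. The resulting scheme has a local description as above by the
computations of [1, 4.27]. Hence we arrive at a regular scheme `X'` with an action of `G` and a
`G`-stable normal crossings divisor"). Abstract form over an invariant `P X p ρ Z n` of
`G`-schemes `p : X ⟶ Spec k` with boundary `Z ⊆ X` and measure `n` (in the source: Situation
4.25 with `n` the number of irreducible components of `Sing X`): if `P` forces `X` integral and
projective, measure `0` forces `X` regular with `Z` a normal crossings divisor (4.28 with the
formal/étale comparison), and positive measure produces a non-zero `G`-stable ideal sheaf (the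
reduced ideal of an orbit of components of `Sing X`) such that every equivariant projective
blow-up `π` in it satisfies `P` with boundary `π⁻¹ Z` and smaller measure (Claim 4.27), then there
is a `G`-equivariant modification `ψ : X' ⟶ X` with `X'` integral, projective and regular and
`ψ⁻¹ Z` a normal crossings divisor. Proof: strong induction on `n`; blow up
(`exists_equivariant_isBlowup`), recurse upstairs, compose (2.17).
[cite: DeJong1997, proof of Prop. 5.11, p. 619] [cite: DeJong1996, 4.26–4.28, pp. 75–76] -/
theorem exists_equivariant_modification_of_invariant {k : Type} [Field k] {G : Type} [Group G]
    (P : ∀ (X : Scheme.{0}), (X ⟶ Spec (.of k)) → (G →* Aut X) → Set X → ℕ → Prop)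
    (hint : ∀ (X : Scheme.{0}) (p : X ⟶ Spec (.of k)) (ρ : G →* Aut X) (Z : Set X) (n : ℕ),
      P X p ρ Z n → IsIntegral X)
    (hproj : ∀ (X : Scheme.{0}) (p : X ⟶ Spec (.of k)) (ρ : G →* Aut X) (Z : Set X) (n : ℕ),
      P X p ρ Z n → Motives.IsProjectiveOver (Over.mk p))
    (hzero : ∀ (X : Scheme.{0}) (p : X ⟶ Spec (.of k)) (ρ : G →* Aut X) (Z : Set X),
      P X p ρ Z 0 → Scheme.IsRegular X ∧ IsNormalCrossingsDivisor X Z)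
    (hstep : ∀ (X : Scheme.{0}) (p : X ⟶ Spec (.of k)) (ρ : G →* Aut X) (Z : Set X) (n : ℕ),
      P X p ρ Z (n + 1) →
        ∃ I : X.IdealSheafData, I ≠ ⊥ ∧ (∀ g : G, I.comap (ρ g).hom = I) ∧
          ∀ (X' : Scheme.{0}) (π : X' ⟶ X) (ρ' : G →* Aut X'), IsBlowup π I →
            (∀ g : G, (ρ' g).hom ≫ π = π ≫ (ρ g).hom) →
              Motives.IsProjectiveOver (Over.mk (π ≫ p)) →
                ∃ m ≤ n, P X' (π ≫ p) ρ' (π.base ⁻¹' Z) m)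
    {X : Scheme.{0}} {p : X ⟶ Spec (.of k)} {ρ : G →* Aut X} {Z : Set X} {n : ℕ}
    (h : P X p ρ Z n) :
    ∃ (X' : Scheme.{0}) (_ : IsIntegral X') (ψ : X' ⟶ X) (ρ' : G →* Aut X'),
      IsModification ψ ∧ (∀ g : G, (ρ' g).hom ≫ ψ = ψ ≫ (ρ g).hom) ∧
        Motives.IsProjectiveOver (Over.mk (ψ ≫ p)) ∧ Scheme.IsRegular X' ∧
          IsNormalCrossingsDivisor X' (ψ.base ⁻¹' Z) := by
  suffices H : ∀ (n : ℕ) (X : Scheme.{0}) (p : X ⟶ Spec (.of k)) (ρ : G →* Aut X) (Z : Set X),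
      P X p ρ Z n →
        ∃ (X' : Scheme.{0}) (_ : IsIntegral X') (ψ : X' ⟶ X) (ρ' : G →* Aut X'),
          IsModification ψ ∧ (∀ g : G, (ρ' g).hom ≫ ψ = ψ ≫ (ρ g).hom) ∧
            Motives.IsProjectiveOver (Over.mk (ψ ≫ p)) ∧ Scheme.IsRegular X' ∧
              IsNormalCrossingsDivisor X' (ψ.base ⁻¹' Z) from
    H n X p ρ Z h
  intro n
  induction n using Nat.strong_induction_on with
  | _ n ih =>
    intro X p ρ Z h
    haveI : IsIntegral X := hint X p ρ Z n h
    rcases n with _ | n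
    · -- measure `0`: `X` is already regular with `Z` a normal crossings divisor
      obtain ⟨hreg, hnc⟩ := hzero X p ρ Z h
      refine ⟨X, inferInstance, 𝟙 X, ρ, isModification_id X, fun g => by simp, ?_, hreg, ?_⟩
      · simpa only [Category.id_comp] using hproj X p ρ Z 0 h
      · simpa using hnc
    · -- positive measure: blow up the `G`-stable centre, recurse upstairs, compose
      obtain ⟨I, hI, hIG, hP⟩ := hstep X p ρ Z n h
      obtain ⟨X₁, _, π, ρ₁, hπ, hmod, hequiv, hproj₁⟩ :=
        exists_equivariant_isBlowup p (hproj X p ρ Z _ h) ρ I hI hIG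
      obtain ⟨m, hm, h₁⟩ := hP X₁ π ρ₁ hπ hequiv hproj₁
      obtain ⟨X', hX', ψ, ρ', hmod', hequiv', hproj', hreg', hnc'⟩ :=
        ih m (Nat.lt_succ_of_le hm) X₁ (π ≫ p) ρ₁ (π.base ⁻¹' Z) h₁
      refine ⟨X', hX', ψ ≫ π, ρ', hmod'.comp hmod, fun g => ?_, ?_, hreg', ?_⟩
      · rw [Category.assoc, ← hequiv g, reassoc_of% (hequiv' g)]
      · simpa only [Category.assoc] using hproj'
      · have e : ((ψ ≫ π).base ⁻¹' Z : Set X') = ψ.base ⁻¹' (π.base ⁻¹' Z) := by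
          ext x
          simp
        rw [e]
        exact hnc'

/-- **Stub B from an invariant**: the conclusion of `stub_pair_ssOrbitBlowup` VERBATIM (a
`G`-equivariant modification `ψ : X' ⟶ X`, `X'` integral, projective over `k` and regular,
`ψ⁻¹(⋃ᵢ τᵢ(Y) ∪ f⁻¹ D)` a normal crossings divisor) for every `G`-scheme `f ≫ q : X ⟶ Spec k`
with boundary `Z = ⋃ᵢ τᵢ(Y) ∪ f⁻¹ D` carrying an invariant `P` as in
`exists_equivariant_modification_of_invariant` (de Jong 1997, proof of Prop. 5.11 ¶2–3: the
invariant is "complete local rings `A⟦u,v⟧/(uv - t₁ ⋯ t_s)`, boundary `t₁ ⋯ t_r = 0`, any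
`G`-orbit of a component of the singular locus nonsingular", the measure the number of
components of `Sing X`). [cite: DeJong1997, proof of Prop. 5.11, p. 619] -/
theorem ssOrbitBlowup_of_invariant {k : Type} [Field k] {X Y : Scheme.{0}} (f : X ⟶ Y)
    (q : Y ⟶ Spec (.of k)) (D : Set Y) {m : ℕ} (τ : Fin m → (Y ⟶ X)) {G : Type} [Group G]
    (ρX : G →* Aut X)
    (P : ∀ (X : Scheme.{0}), (X ⟶ Spec (.of k)) → (G →* Aut X) → Set X → ℕ → Prop)
    (hint : ∀ (X : Scheme.{0}) (p : X ⟶ Spec (.of k)) (ρ : G →* Aut X) (Z : Set X) (n : ℕ),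
      P X p ρ Z n → IsIntegral X)
    (hproj : ∀ (X : Scheme.{0}) (p : X ⟶ Spec (.of k)) (ρ : G →* Aut X) (Z : Set X) (n : ℕ),
      P X p ρ Z n → Motives.IsProjectiveOver (Over.mk p))
    (hzero : ∀ (X : Scheme.{0}) (p : X ⟶ Spec (.of k)) (ρ : G →* Aut X) (Z : Set X),
      P X p ρ Z 0 → Scheme.IsRegular X ∧ IsNormalCrossingsDivisor X Z)
    (hstep : ∀ (X : Scheme.{0}) (p : X ⟶ Spec (.of k)) (ρ : G →* Aut X) (Z : Set X) (n : ℕ),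
      P X p ρ Z (n + 1) →
        ∃ I : X.IdealSheafData, I ≠ ⊥ ∧ (∀ g : G, I.comap (ρ g).hom = I) ∧
          ∀ (X' : Scheme.{0}) (π : X' ⟶ X) (ρ' : G →* Aut X'), IsBlowup π I →
            (∀ g : G, (ρ' g).hom ≫ π = π ≫ (ρ g).hom) →
              Motives.IsProjectiveOver (Over.mk (π ≫ p)) →
                ∃ m ≤ n, P X' (π ≫ p) ρ' (π.base ⁻¹' Z) m)
    {n : ℕ} (h : P X (f ≫ q) ρX (DeJong1996.semiStableBoundary f D τ) n) :
    ∃ (X' : Scheme.{0}) (_ : IsIntegral X') (ψ : X' ⟶ X) (ρX' : G →* Aut X'),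
      IsModification ψ ∧ (∀ g : G, (ρX' g).hom ≫ ψ = ψ ≫ (ρX g).hom) ∧
        Motives.IsProjectiveOver (Over.mk ((ψ ≫ f) ≫ q)) ∧ Scheme.IsRegular X' ∧
          IsNormalCrossingsDivisor X' (ψ.base ⁻¹' DeJong1996.semiStableBoundary f D τ) := by
  obtain ⟨X', hX', ψ, ρ', hmod, hequiv, hproj', hreg, hnc⟩ :=
    exists_equivariant_modification_of_invariant P hint hproj hzero hstep h
  exact ⟨X', hX', ψ, ρ', hmod, hequiv, by simpa only [Category.assoc] using hproj', hreg, hnc⟩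

/-! ## Sanity of the abstraction: the algebraically closed, non-equivariant case -/

/-- **Sanity of the invariant interface** (de Jong 1996, 4.25–4.28 recovered): over an
algebraically closed field, for a pair `(X, Z)` in Situation 4.25 (`DeJong1996.NormalFormPair`),
the invariant `P X p ρ Z n := NormalFormPair p Z d ∧ #components(Sing X) = n ∧ ρ = 1` satisfies
the hypotheses of `exists_equivariant_modification_of_invariant` for ANY group `G` acting
trivially: `hzero` is "no singular component ⇒ regular" with the formal/étale comparison
(`DeJong1996FormalNormalCrossings`), `hstep` is Claim 4.27 (`DeJong1996NormalFormPairBlowup`) for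
the reduced ideal of one component (stable under the trivial action; the lifted action is again
trivial by uniqueness of lifts through a blow-up, `IsBlowup.eq_id_of_comp_eq`). Hence a
projective modification `ψ : X' ⟶ X` with `X'` regular and `ψ⁻¹ Z` a normal crossings divisor —
the conclusion of `DeJong1996CodimThreeModification` for pairs in normal form, as in the tree's
`DeJong1996.NormalFormPair.exists_isModification_isRegular`. Both leaves are proved in the tree
(`…_holds`); they are taken as hypotheses here only to keep this file's imports light.
[cite: DeJong1996, 4.25–4.28, pp. 75–76] -/
theorem normalFormPair_exists_isModification_of_invariant
    (hB : DeJong1996NormalFormPairBlowup.{0}) (hF : DeJong1996FormalNormalCrossings.{0})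
    {k : Type} [Field k] [IsAlgClosed k] {G : Type} [Group G]
    {X : Scheme.{0}} {f : X ⟶ Spec (.of k)} {Z : Set X} {d : ℕ}
    (h : DeJong1996.NormalFormPair f Z d) :
    ∃ (X' : Scheme.{0}) (_ : IsIntegral X') (ψ : X' ⟶ X) (ρ' : G →* Aut X'),
      IsModification ψ ∧ (∀ g : G, (ρ' g).hom ≫ ψ = ψ ≫ ((1 : G →* Aut X) g).hom) ∧
        Motives.IsProjectiveOver (Over.mk (ψ ≫ f)) ∧ Scheme.IsRegular X' ∧
          IsNormalCrossingsDivisor X' (ψ.base ⁻¹' Z) := by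
  let P : ∀ (X : Scheme.{0}), (X ⟶ Spec (.of k)) → (G →* Aut X) → Set X → ℕ → Prop :=
    fun X p ρ Z n => DeJong1996.NormalFormPair p Z d ∧
      (irreducibleComponents
        ↥({x : X | ¬ IsRegularLocalRing (X.presheaf.stalk x)} : Set X)).ncard = n ∧
      ∀ g, ρ g = 1
  have hP : P X f 1 Z _ := ⟨h, rfl, fun g => rfl⟩
  refine exists_equivariant_modification_of_invariant P (fun X p ρ Z n hP => hP.1.isIntegral)
    (fun X p ρ Z n hP => hP.1.isProjectiveOver) (fun X p ρ Z hP => ?_)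
    (fun X p ρ Z n hP => ?_) hP
  · -- measure `0`: no singular component, so `X` is regular; `Z` is a normal crossings divisor
    obtain ⟨hN, hn, -⟩ := hP
    haveI := hN.isIntegral
    haveI := hN.isNoetherian
    have hfin : (irreducibleComponents
        ↥({x : X | ¬ IsRegularLocalRing (X.presheaf.stalk x)} : Set X)).Finite :=
      NoetherianSpace.finite_irreducibleComponents
    have hreg := hN.isRegular_of_irreducibleComponents_eq_empty ((Set.ncard_eq_zero hfin).mp hn)
    exact ⟨hreg, hF k X p Z d hN hreg⟩
  · -- positive measure: Claim 4.27 for the reduced ideal of one singular component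
    obtain ⟨hN, hn, hρ⟩ := hP
    haveI := hN.isIntegral
    haveI := hN.isNoetherian
    obtain ⟨E, hE⟩ : (irreducibleComponents
        ↥({x : X | ¬ IsRegularLocalRing (X.presheaf.stalk x)} : Set X)).Nonempty := by
      rw [Set.nonempty_iff_ne_empty]
      intro he
      rw [he, Set.ncard_empty] at hn
      exact Nat.succ_ne_zero n hn.symm
    refine ⟨Scheme.IdealSheafData.vanishingIdeal ⟨closure (Subtype.val '' E), isClosed_closure⟩,
      hN.vanishingIdeal_ne_bot E, fun g => ?_, fun X' π ρ' hπ hequiv hproj' => ?_⟩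
    · rw [hρ g]
      exact Scheme.IdealSheafData.comap_id _
    · obtain ⟨h₁, hcount⟩ := hB k X p Z d hN E hE X' π hπ hproj'
      refine ⟨_, by omega, h₁, rfl, fun g => ?_⟩
      -- the lifted action is trivial: an endomorphism of the blow-up over `X` is the identity
      ext : 1
      apply hπ.eq_id_of_comp_eq
      rw [hequiv g, hρ g]
      exact Category.comp_id π

/-! ## Orbit centres: the singular locus and orbits of closed subsets under the action -/

/-- **The singular locus is stable under isomorphisms**: an isomorphism `e : X ≅ Y` identifies
the local rings `𝒪_{Y, e x} ≅ 𝒪_{X, x}`, so `x` is a regular point iff `e x` is.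
[folklore] -/
theorem preimage_setOf_not_isRegularLocalRing_eq {X Y : Scheme.{0}} (e : X ≅ Y) :
    e.hom.base ⁻¹' {y : Y | ¬ IsRegularLocalRing (Y.presheaf.stalk y)} =
      {x : X | ¬ IsRegularLocalRing (X.presheaf.stalk x)} := by
  ext x
  simp only [Set.mem_preimage, Set.mem_setOf_eq, not_iff_not]
  have i := (asIso (e.hom.stalkMap x)).commRingCatIsoToRingEquiv
  exact ⟨fun h => IsRegularLocalRing.of_ringEquiv i, fun h => IsRegularLocalRing.of_ringEquiv i.symm⟩

/-- The singular locus `Sing X = {x | 𝒪_{X,x} not regular}` is stable under every automorphism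
of an action: `(ρ g)⁻¹ Sing X = Sing X`. [folklore] -/
theorem preimage_singularLocus_eq_of_action {X : Scheme.{0}} {G : Type} [Group G]
    (ρ : G →* Aut X) (g : G) :
    (ρ g).hom.base ⁻¹' {x : X | ¬ IsRegularLocalRing (X.presheaf.stalk x)} =
      {x : X | ¬ IsRegularLocalRing (X.presheaf.stalk x)} :=
  preimage_setOf_not_isRegularLocalRing_eq (ρ g)

/-- The singular locus is stable under every automorphism of an action, image form:
`(ρ g) '' Sing X = Sing X`. [folklore] -/
theorem image_singularLocus_eq_of_action {X : Scheme.{0}} {G : Type} [Group G]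
    (ρ : G →* Aut X) (g : G) :
    (ρ g).hom.base '' {x : X | ¬ IsRegularLocalRing (X.presheaf.stalk x)} =
      {x : X | ¬ IsRegularLocalRing (X.presheaf.stalk x)} := by
  refine image_eq_of_forall_image_subset ρ _ (fun g => ?_) g
  rintro _ ⟨x, hx, rfl⟩
  have h := preimage_singularLocus_eq_of_action ρ g
  rw [Set.ext_iff] at h
  exact (h x).mpr hx

/-- Translating a translate: `(ρ h) '' ((ρ g) '' E) = (ρ (h * g)) '' E` (recall
`(a * b).hom = b.hom ≫ a.hom` in `Aut X`). [folklore] -/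
theorem image_image_eq_of_action {X : Scheme.{0}} {G : Type} [Group G] (ρ : G →* Aut X)
    (h g : G) (E : Set X) :
    (ρ h).hom.base '' ((ρ g).hom.base '' E) = (ρ (h * g)).hom.base '' E := by
  rw [Set.image_image, map_mul]
  rfl

/-- **An orbit of a closed subset is closed**: for `G` finite and `E ⊆ X` closed, the union
`⋃_g (ρ g) '' E` of its translates is closed (each translate is closed, an automorphism being a
homeomorphism). [folklore] -/
theorem isClosed_iUnion_image {X : Scheme.{0}} {G : Type} [Group G] [Finite G]
    (ρ : G →* Aut X) {E : Set X} (hE : IsClosed E) :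
    IsClosed (⋃ g : G, (ρ g).hom.base '' E) :=
  isClosed_iUnion_of_finite fun g =>
    (Scheme.homeoOfIso (ρ g)).isClosedMap E hE

/-- **An orbit of a subset is `G`-stable**, image form: `(ρ h) '' ⋃_g (ρ g) '' E = ⋃_g (ρ g) '' E`.
[folklore] -/
theorem image_iUnion_image_eq {X : Scheme.{0}} {G : Type} [Group G] (ρ : G →* Aut X)
    (E : Set X) (h : G) :
    (ρ h).hom.base '' (⋃ g : G, (ρ g).hom.base '' E) = ⋃ g : G, (ρ g).hom.base '' E := by
  refine image_eq_of_forall_image_subset ρ _ (fun h => ?_) h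
  rw [Set.image_iUnion]
  refine Set.iUnion_subset fun g => ?_
  rw [image_image_eq_of_action]
  exact Set.subset_iUnion (fun g : G => (ρ g).hom.base '' E) (h * g)

/-- **An orbit of a subset is `G`-stable**, preimage form (the hypothesis of
`vanishingIdeal_comap_eq_of_action`): `(ρ h)⁻¹ ⋃_g (ρ g) '' E = ⋃_g (ρ g) '' E`. [folklore] -/
theorem preimage_iUnion_image_eq {X : Scheme.{0}} {G : Type} [Group G] (ρ : G →* Aut X)
    (E : Set X) (h : G) :
    (ρ h).hom.base ⁻¹' (⋃ g : G, (ρ g).hom.base '' E) = ⋃ g : G, (ρ g).hom.base '' E := by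
  rw [← image_inv_eq_preimage_hom]
  have e : (ρ h).inv = (ρ h⁻¹).hom := by
    rw [map_inv, CategoryTheory.Aut.Aut_inv_def]
    rfl
  rw [e]
  exact image_iUnion_image_eq ρ E h⁻¹

/-- **The reduced ideal sheaf of an orbit is `G`-stable**: for a closed `E ⊆ X` and `G` finite,
the vanishing ideal sheaf of the closed orbit `⋃_g (ρ g) '' E` is preserved by every `(ρ g)⁻¹` —
so the action lifts to the blow-up of `X` in it (`IsBlowup.liftAction`). [folklore] -/
theorem vanishingIdeal_orbit_comap_eq {X : Scheme.{0}} {G : Type} [Group G] [Finite G]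
    (ρ : G →* Aut X) {E : Set X} (hE : IsClosed E) (g : G) :
    (Scheme.IdealSheafData.vanishingIdeal
        ⟨⋃ g : G, (ρ g).hom.base '' E, isClosed_iUnion_image ρ hE⟩).comap (ρ g).hom =
      Scheme.IdealSheafData.vanishingIdeal
        ⟨⋃ g : G, (ρ g).hom.base '' E, isClosed_iUnion_image ρ hE⟩ :=
  vanishingIdeal_comap_eq_of_action ρ _ (fun h => preimage_iUnion_image_eq ρ E h) g

/-- **The reduced ideal sheaf of a proper closed subset is non-zero**: its support is the subset
itself, while the zero ideal sheaf is supported everywhere. [folklore] -/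
theorem vanishingIdeal_ne_bot_of_ne_univ {X : Scheme.{0}} (Z : Closeds X)
    (hZ : (Z : Set X) ≠ Set.univ) : Scheme.IdealSheafData.vanishingIdeal Z ≠ ⊥ := by
  intro hbot
  apply hZ
  have := congrArg (fun I : X.IdealSheafData => ((I.support : Closeds X) : Set X)) hbot
  simpa [Scheme.IdealSheafData.coe_support_vanishingIdeal,
    Scheme.IdealSheafData.support_bot] using this

/-- A closed subset of an integral scheme contained in the singular locus is a proper subset (the
generic point is a regular point, its local ring being the function field), so its reduced ideal
sheaf is a legitimate (non-zero) blow-up centre. [folklore] -/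
theorem ne_univ_of_subset_singularLocus {X : Scheme.{0}} [IsIntegral X] {T : Set X}
    (hT : T ⊆ {x : X | ¬ IsRegularLocalRing (X.presheaf.stalk x)}) : T ≠ Set.univ := by
  intro h
  have hη : genericPoint X ∈ T := h ▸ Set.mem_univ _
  apply hT hη
  show IsRegularLocalRing X.functionField
  infer_instance

/-- **The orbit of a subset of the singular locus lies in the singular locus** (the singular
locus being stable under the action). [folklore] -/
theorem iUnion_image_subset_singularLocus {X : Scheme.{0}} {G : Type} [Group G]
    (ρ : G →* Aut X) {E : Set X} (hE : E ⊆ {x : X | ¬ IsRegularLocalRing (X.presheaf.stalk x)}) :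
    (⋃ g : G, (ρ g).hom.base '' E) ⊆ {x : X | ¬ IsRegularLocalRing (X.presheaf.stalk x)} :=
  Set.iUnion_subset fun g => (Set.image_mono hE).trans (image_singularLocus_eq_of_action ρ g).le

end Summit.ResolutionOfSingularities.ResolutionOfSingularities.Theorems

end
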